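import Mathlib
import HarnessLib

/-!
# ValiantsHypothesis / SymPencil — crux `EquivariantSdcNotQP` (stmt-ValiantsHypothesis-17792),
# line `birth_EquivariantSdcNotQP`, stub `stub_permify`, piece (iii′) `PermEmbeddingQP`:
# the honest partial «permutation embedding at EXPONENTIAL cost» (helper)

Piece (iii′) `PermEmbeddingQP` of `stub_permify` (docstring of
`permify_of_finiteLift_of_permEmbedding`, `…PermifyReduction.lean`) asks: for every subgroup
`F ≤ (𝔖_n × 𝔖_n) × GL_{m₀}(ℂ)` with scalar, unimodular fibre over `(1,1)`, the `F`-module `ℂ^{m₀}`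
is an equivariant retract (`p ι = 1`, `P_τ ι = ι g`, `p P_τ = g p`) of a PERMUTATION `F`-module
of QUASI-POLYNOMIAL dimension `≤ 2^{(log₂ m₀ + log₂ n + d)^d}`.

This file proves the same retract statement UNCONDITIONALLY but at EXPONENTIAL cost
`m' ≤ m₀² · (n!)²` (`permEmbedding_regular`; `permEmbeddingQP_of_large` for the regime where this IS quasi-polynomial):
such an `F` is finite of order `≤ m₀ · (n!)²`
(`finite_liftGroup`, `card_liftGroup_le` — the fibre over `(1,1)` consists of scalar `m₀`-th
roots of unity), and `ℂ^{m₀}` is a retract of the permutation module `ℂ[F × [m₀]]`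
(`F` acting by left translation on itself): `ι v = (g_f⁻¹ v)_{f ∈ F}`, `p w = |F|⁻¹ ∑_f g_f w_f`
(the averaging retraction), `τ_x =` left translation by `x⁻¹`.  No representation theory is used.

Corollary (separate file `…PermifyExponential.lean`, over the landed (i), (ii′), (iv)): the
conclusion of `stub_permify` with budget `m² (n!)²` instead of quasi-polynomial, unconditionally —
so the only open content of `stub_permify` is the BUDGET.

Consequence for the line: (iii′) HOLDS whenever `log₂ m₀ ≥ √(2 n log₂ n)` (then
`m₀² (n!)² ≤ 2^{(log₂ m₀ + log₂ n + 2)^2}`), so the open core of (iii′) — hence of `stub_permify` —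
is the regime of SMALL pencils `m₀ < 2^{√(2 n log₂ n)}`, i.e. exactly Young's rule + degree bounds
for the small constituents (`𝔖_n × 𝔖_n` and its double covers), as the line card says.

Honest framing: a partial result; (iii′), `stub_permify`, the crux `EquivariantSdcNotQP` and
`VP ≠ VNP` remain OPEN.  Helper file (`--supports stmt-ValiantsHypothesis-17792 --as helper`);
0 definitions, 0 named facts; all statements folklore.
-/

noncomputable section

set_option linter.dupNamespace false

namespace Summit.ValiantsHypothesis.ValiantsHypothesis.Theorems.SymPencilEquivariantSdcNotQP.PermEmbedding

open Matrix

variable {n m₀ : ℕ}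

/-- Elements of the lift group over the identity pair are scalar `m₀`-th roots of unity.
[folklore] -/
theorem fibre_scalar (F : Subgroup ((Equiv.Perm (Fin n) × Equiv.Perm (Fin n)) × GL (Fin m₀) ℂ))
    (hscal : ∀ g : GL (Fin m₀) ℂ, ((1 : Equiv.Perm (Fin n) × Equiv.Perm (Fin n)), g) ∈ F →
      ∃ c : ℂ, (g : Matrix (Fin m₀) (Fin m₀) ℂ) = c • (1 : Matrix (Fin m₀) (Fin m₀) ℂ))
    (hdet : ∀ x ∈ F, Matrix.det (x.2 : Matrix (Fin m₀) (Fin m₀) ℂ) = 1)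
    (x : (Equiv.Perm (Fin n) × Equiv.Perm (Fin n)) × GL (Fin m₀) ℂ) (hx : x ∈ F) (hx1 : x.1 = 1) :
    ∃ c : ℂ, c ^ m₀ = 1 ∧ (x.2 : Matrix (Fin m₀) (Fin m₀) ℂ) = c • (1 : Matrix (Fin m₀) (Fin m₀) ℂ) := by
  have hmem : ((1 : Equiv.Perm (Fin n) × Equiv.Perm (Fin n)), x.2) ∈ F := by
    have : x = (x.1, x.2) := rfl
    rw [this, hx1] at hx
    exact hx
  obtain ⟨c, hc⟩ := hscal _ hmem
  refine ⟨c, ?_, hc⟩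
  have hd := hdet x hx
  rw [hc, Matrix.det_smul, Matrix.det_one, mul_one, Fintype.card_fin] at hd
  exact hd

/-- **Finiteness of the lift group.**  A subgroup `F ≤ (𝔖_n × 𝔖_n) × GL_{m₀}(ℂ)` (`m₀ ≥ 1`) whose
fibre over `(1,1)` is scalar and unimodular is finite of order `≤ m₀ · (n!)²`: the fibre embeds into
the `m₀`-th roots of unity and the image into `𝔖_n × 𝔖_n`. [folklore] -/
theorem card_liftGroup_le (hm₀ : 1 ≤ m₀)
    (F : Subgroup ((Equiv.Perm (Fin n) × Equiv.Perm (Fin n)) × GL (Fin m₀) ℂ))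
    (hscal : ∀ g : GL (Fin m₀) ℂ, ((1 : Equiv.Perm (Fin n) × Equiv.Perm (Fin n)), g) ∈ F →
      ∃ c : ℂ, (g : Matrix (Fin m₀) (Fin m₀) ℂ) = c • (1 : Matrix (Fin m₀) (Fin m₀) ℂ))
    (hdet : ∀ x ∈ F, Matrix.det (x.2 : Matrix (Fin m₀) (Fin m₀) ℂ) = 1) :
    Finite F ∧ Nat.card F ≤ m₀ * (Nat.factorial n) ^ 2 := by
  classical
  let f : F →* Equiv.Perm (Fin n) × Equiv.Perm (Fin n) :=
    (MonoidHom.fst _ (GL (Fin m₀) ℂ)).comp F.subtype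
  have hf : ∀ x : F, f x = ((x : (Equiv.Perm (Fin n) × Equiv.Perm (Fin n)) × GL (Fin m₀) ℂ)).1 :=
    fun x => rfl
  -- kernel elements: scalar roots of unity
  have hker : ∀ x : F, x ∈ f.ker → ∃ c : ℂ, c ^ m₀ = 1 ∧
      (((x : (Equiv.Perm (Fin n) × Equiv.Perm (Fin n)) × GL (Fin m₀) ℂ)).2 :
        Matrix (Fin m₀) (Fin m₀) ℂ) = c • (1 : Matrix (Fin m₀) (Fin m₀) ℂ) := by
    intro x hx
    rw [MonoidHom.mem_ker, hf] at hx
    exact fibre_scalar F hscal hdet _ x.2 hx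
  let i₀ : Fin m₀ := ⟨0, hm₀⟩
  let ψ : f.ker → ↥(Polynomial.nthRootsFinset m₀ (1 : ℂ)) := fun x =>
    ⟨(((x : F) : (Equiv.Perm (Fin n) × Equiv.Perm (Fin n)) × GL (Fin m₀) ℂ).2 :
        Matrix (Fin m₀) (Fin m₀) ℂ) i₀ i₀, by
      obtain ⟨c, hc, hx⟩ := hker x x.2
      rw [Polynomial.mem_nthRootsFinset hm₀, hx]
      simpa using hc⟩
  have hψ : Function.Injective ψ := by
    intro x y hxy
    obtain ⟨c, -, hx⟩ := hker x x.2
    obtain ⟨c', -, hy⟩ := hker y y.2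
    have hcc : c = c' := by
      have h := congrArg Subtype.val hxy
      simp only [ψ, hx, hy, Matrix.smul_apply, Matrix.one_apply_eq, smul_eq_mul, mul_one] at h
      exact h
    have hx1 : (((x : F) : (Equiv.Perm (Fin n) × Equiv.Perm (Fin n)) × GL (Fin m₀) ℂ)).1 = 1 := by
      rw [← hf]; exact (MonoidHom.mem_ker).mp x.2
    have hy1 : (((y : F) : (Equiv.Perm (Fin n) × Equiv.Perm (Fin n)) × GL (Fin m₀) ℂ)).1 = 1 := by
      rw [← hf]; exact (MonoidHom.mem_ker).mp y.2
    apply Subtype.ext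
    apply Subtype.ext
    refine Prod.ext (hx1.trans hy1.symm) (Units.ext ?_)
    rw [hx, hy, hcc]
  have hker_fin : Finite f.ker := Finite.of_injective ψ hψ
  have hker_card : Nat.card f.ker ≤ m₀ := by
    refine (Nat.card_le_card_of_injective ψ hψ).trans ?_
    rw [Nat.card_eq_fintype_card, Fintype.card_coe, Polynomial.nthRootsFinset_def]
    exact (Multiset.toFinset_card_le _).trans (Polynomial.card_nthRoots _ _)
  have hrange_card : Nat.card f.range ≤ (Nat.factorial n) ^ 2 := by
    calc Nat.card f.range ≤ Nat.card (Equiv.Perm (Fin n) × Equiv.Perm (Fin n)) :=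
          Nat.card_le_card_of_injective _ Subtype.val_injective
      _ = (Nat.factorial n) ^ 2 := by
          rw [Nat.card_prod, Nat.card_eq_fintype_card, Fintype.card_perm, Fintype.card_fin, sq]
  have hcard : Nat.card F = Nat.card f.range * Nat.card f.ker := by
    rw [← Subgroup.index_ker, Subgroup.index_mul_card]
  have hrange_pos : 0 < Nat.card f.range := Nat.card_pos
  have hker_pos : 0 < Nat.card f.ker := Nat.card_pos
  refine ⟨Nat.finite_of_card_ne_zero ?_, ?_⟩
  · rw [hcard]; exact Nat.mul_ne_zero hrange_pos.ne' hker_pos.ne'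
  · rw [hcard, mul_comm]
    exact Nat.mul_le_mul hker_card hrange_card

/-- **Permutation embedding at exponential cost** (honest partial of piece (iii′)
`PermEmbeddingQP` of `stub_permify`).  For a subgroup `F ≤ (𝔖_n × 𝔖_n) × GL_{m₀}(ℂ)` with scalar
unimodular fibre over `(1,1)`, the `F`-module `ℂ^{m₀}` is an equivariant retract of a PERMUTATION
`F`-module of dimension `m' ≤ m₀² · (n!)²` — namely `ℂ[F × [m₀]]` with `F` acting by left
translation: `ι v = (g_f⁻¹ v)_f`, `p w = |F|⁻¹ ∑_f g_f w_f`, `τ_x` = left translation by `x⁻¹`.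
The conclusion is that of (iii′) with the quasi-polynomial bound replaced by `m₀² (n!)²`; no
representation theory enters. [folklore] -/
theorem permEmbedding_regular (n m₀ : ℕ)
    (F : Subgroup ((Equiv.Perm (Fin n) × Equiv.Perm (Fin n)) × GL (Fin m₀) ℂ))
    (hscal : ∀ g : GL (Fin m₀) ℂ, ((1 : Equiv.Perm (Fin n) × Equiv.Perm (Fin n)), g) ∈ F →
      ∃ c : ℂ, (g : Matrix (Fin m₀) (Fin m₀) ℂ) = c • (1 : Matrix (Fin m₀) (Fin m₀) ℂ))
    (hdet : ∀ x ∈ F, Matrix.det (x.2 : Matrix (Fin m₀) (Fin m₀) ℂ) = 1) :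
    ∃ m' ≤ m₀ ^ 2 * (Nat.factorial n) ^ 2,
      ∃ (ι : Matrix (Fin m') (Fin m₀) ℂ) (p : Matrix (Fin m₀) (Fin m') ℂ)
        (τ : (Equiv.Perm (Fin n) × Equiv.Perm (Fin n)) × GL (Fin m₀) ℂ → Equiv.Perm (Fin m')),
        p * ι = 1 ∧ ∀ x ∈ F,
          (τ x).permMatrix ℂ * ι = ι * (x.2 : Matrix (Fin m₀) (Fin m₀) ℂ) ∧
          p * (τ x).permMatrix ℂ = (x.2 : Matrix (Fin m₀) (Fin m₀) ℂ) * p := by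
  classical
  rcases Nat.eq_zero_or_pos m₀ with rfl | hm₀
  · -- `m₀ = 0`: all matrices involved have a `Fin 0` side
    refine ⟨0, Nat.zero_le _, 0, 0, fun _ => 1, ?_, fun x _ => ⟨?_, ?_⟩⟩
    · ext i; exact Fin.elim0 i
    · ext i; exact Fin.elim0 i
    · ext i; exact Fin.elim0 i
  obtain ⟨hfin, hcard⟩ := card_liftGroup_le hm₀ F hscal hdet
  letI : Fintype F := Fintype.ofFinite F
  set N : ℕ := Fintype.card F with hN
  have hN0 : (N : ℂ) ≠ 0 := by exact_mod_cast Fintype.card_ne_zero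
  let e : F × Fin m₀ ≃ Fin (Fintype.card (F × Fin m₀)) := Fintype.equivFin _
  -- the matrices attached to an element of `F`
  let g : F → Matrix (Fin m₀) (Fin m₀) ℂ := fun f =>
    (((f : (Equiv.Perm (Fin n) × Equiv.Perm (Fin n)) × GL (Fin m₀) ℂ).2 : GL (Fin m₀) ℂ) :
      Matrix (Fin m₀) (Fin m₀) ℂ)
  let gi : F → Matrix (Fin m₀) (Fin m₀) ℂ := fun f =>
    ((((f : (Equiv.Perm (Fin n) × Equiv.Perm (Fin n)) × GL (Fin m₀) ℂ).2)⁻¹ : GL (Fin m₀) ℂ) :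
      Matrix (Fin m₀) (Fin m₀) ℂ)
  have hggi : ∀ f, g f * gi f = 1 := fun f => Units.mul_inv _
  have hg_mul : ∀ f f' : F, g (f * f') = g f * g f' := fun f f' => by
    simp only [g, Subgroup.coe_mul, Prod.snd_mul, Units.val_mul]
  have hgi_mul : ∀ f f' : F, gi (f * f') = gi f' * gi f := fun f f' => by
    simp only [gi, Subgroup.coe_mul, Prod.snd_mul, _root_.mul_inv_rev, Units.val_mul]
  have hgi_inv : ∀ f : F, gi f⁻¹ = g f := fun f => by
    simp only [gi, g, Subgroup.coe_inv, Prod.snd_inv, inv_inv]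
  let ι : Matrix (Fin (Fintype.card (F × Fin m₀))) (Fin m₀) ℂ :=
    Matrix.of fun a j => gi (e.symm a).1 (e.symm a).2 j
  let p : Matrix (Fin m₀) (Fin (Fintype.card (F × Fin m₀))) ℂ :=
    Matrix.of fun j a => (N : ℂ)⁻¹ * g (e.symm a).1 j (e.symm a).2
  let σ : F → Equiv.Perm (Fin (Fintype.card (F × Fin m₀))) := fun y =>
    (e.symm.trans ((Equiv.mulLeft y⁻¹).prodCongr (Equiv.refl (Fin m₀)))).trans e
  have hσ : ∀ y a, e.symm (σ y a) = (y⁻¹ * (e.symm a).1, (e.symm a).2) := by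
    intro y a
    simp [σ, Prod.ext_iff, Prod.map_fst, Prod.map_snd]
  have hσsymm : ∀ y a, e.symm ((σ y).symm a) = (y * (e.symm a).1, (e.symm a).2) := by
    intro y a
    simp [σ, Equiv.prodCongr_symm, Equiv.mulLeft_symm, Prod.ext_iff, Prod.map_fst, Prod.map_snd]
  let τ : (Equiv.Perm (Fin n) × Equiv.Perm (Fin n)) × GL (Fin m₀) ℂ →
      Equiv.Perm (Fin (Fintype.card (F × Fin m₀))) :=
    fun x => if hx : x ∈ F then σ ⟨x, hx⟩ else 1
  refine ⟨Fintype.card (F × Fin m₀), ?_, ι, p, τ, ?_, fun x hx => ?_⟩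
  · -- the size bound
    rw [Fintype.card_prod, Fintype.card_fin, ← Nat.card_eq_fintype_card]
    calc Nat.card F * m₀ ≤ m₀ * (Nat.factorial n) ^ 2 * m₀ := Nat.mul_le_mul_right _ hcard
      _ = m₀ ^ 2 * (Nat.factorial n) ^ 2 := by ring
  · -- `p ι = 1`: averaging `g_f g_f⁻¹ = 1` over `F`
    ext j k
    simp only [Matrix.mul_apply, ι, p, Matrix.of_apply]
    rw [← e.sum_comp]
    simp only [Equiv.symm_apply_apply]
    rw [Fintype.sum_prod_type]
    have hinner : ∀ f : F, ∑ i : Fin m₀, (N : ℂ)⁻¹ * g f j i * gi f i k =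
        (N : ℂ)⁻¹ * (1 : Matrix (Fin m₀) (Fin m₀) ℂ) j k := by
      intro f
      rw [← hggi f, Matrix.mul_apply, Finset.mul_sum]
      refine Finset.sum_congr rfl fun i _ => ?_
      ring
    simp only [hinner, Finset.sum_const, Finset.card_univ, nsmul_eq_mul]
    rw [← hN, ← mul_assoc, mul_inv_cancel₀ hN0, one_mul]
  · have hτ : τ x = σ ⟨x, hx⟩ := dif_pos hx
    have hgx : g ⟨x, hx⟩ = (x.2 : Matrix (Fin m₀) (Fin m₀) ℂ) := rfl
    rw [hτ]
    refine ⟨?_, ?_⟩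
    · -- `P_σ ι = ι g`
      rw [Equiv.Perm.permMatrix, PEquiv.toMatrix_toPEquiv_mul]
      ext a k
      simp only [Matrix.submatrix_apply, id, ι, Matrix.of_apply, Matrix.mul_apply]
      rw [hσ, hgi_mul, hgi_inv, Matrix.mul_apply]
    · -- `p P_σ = g p`
      rw [Equiv.Perm.permMatrix, PEquiv.mul_toMatrix_toPEquiv]
      ext j a
      simp only [Matrix.submatrix_apply, id, p, Matrix.of_apply, Matrix.mul_apply]
      rw [hσsymm, hg_mul, hgx, Matrix.mul_apply, Finset.mul_sum]
      refine Finset.sum_congr rfl fun l _ => ?_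
      ring


/-- **(iii′) in the large-pencil regime.**  If `2(⌊log₂ m₀⌋ + 1) + 2n(⌊log₂ n⌋ + 1) ≤
(⌊log₂ m₀⌋ + ⌊log₂ n⌋ + 2)²` — which holds as soon as `log₂ m₀ ≥ √(2 n (log₂ n + 1)) + 1` — then
`m₀² (n!)² ≤ 2^{(log₂ m₀ + log₂ n + 2)^2}` and the exponential embedding `permEmbedding_regular` IS a
quasi-polynomial one: the conclusion of piece (iii′) `PermEmbeddingQP` holds with `d = 2` for such
`(n, m₀)`.  Hence the open core of (iii′) is the regime of small pencils. [folklore] -/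
theorem permEmbeddingQP_of_large (n m₀ : ℕ)
    (hlarge : 2 * (Nat.log 2 m₀ + 1) + 2 * (n * (Nat.log 2 n + 1)) ≤
      (Nat.log 2 m₀ + Nat.log 2 n + 2) ^ 2)
    (F : Subgroup ((Equiv.Perm (Fin n) × Equiv.Perm (Fin n)) × GL (Fin m₀) ℂ))
    (hscal : ∀ g : GL (Fin m₀) ℂ, ((1 : Equiv.Perm (Fin n) × Equiv.Perm (Fin n)), g) ∈ F →
      ∃ c : ℂ, (g : Matrix (Fin m₀) (Fin m₀) ℂ) = c • (1 : Matrix (Fin m₀) (Fin m₀) ℂ))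
    (hdet : ∀ x ∈ F, Matrix.det (x.2 : Matrix (Fin m₀) (Fin m₀) ℂ) = 1) :
    ∃ m' ≤ 2 ^ ((Nat.log 2 m₀ + Nat.log 2 n + 2) ^ 2),
      ∃ (ι : Matrix (Fin m') (Fin m₀) ℂ) (p : Matrix (Fin m₀) (Fin m') ℂ)
        (τ : (Equiv.Perm (Fin n) × Equiv.Perm (Fin n)) × GL (Fin m₀) ℂ → Equiv.Perm (Fin m')),
        p * ι = 1 ∧ ∀ x ∈ F,
          (τ x).permMatrix ℂ * ι = ι * (x.2 : Matrix (Fin m₀) (Fin m₀) ℂ) ∧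
          p * (τ x).permMatrix ℂ = (x.2 : Matrix (Fin m₀) (Fin m₀) ℂ) * p := by
  obtain ⟨m', hm', ι, p, τ, hpι, hrel⟩ := permEmbedding_regular n m₀ F hscal hdet
  refine ⟨m', hm'.trans ?_, ι, p, τ, hpι, hrel⟩
  -- `m₀ < 2^{L+1}`, `n ! ≤ n^n ≤ 2^{n (L'+1)}`
  have hm₀ : m₀ ≤ 2 ^ (Nat.log 2 m₀ + 1) := (Nat.lt_pow_succ_log_self one_lt_two m₀).le
  have hn : n ≤ 2 ^ (Nat.log 2 n + 1) := (Nat.lt_pow_succ_log_self one_lt_two n).le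
  have hfact : Nat.factorial n ≤ 2 ^ (n * (Nat.log 2 n + 1)) := by
    calc Nat.factorial n ≤ n ^ n := Nat.factorial_le_pow n
      _ ≤ (2 ^ (Nat.log 2 n + 1)) ^ n := Nat.pow_le_pow_left hn n
      _ = 2 ^ (n * (Nat.log 2 n + 1)) := by rw [← pow_mul, mul_comm]
  calc m₀ ^ 2 * (Nat.factorial n) ^ 2
      ≤ (2 ^ (Nat.log 2 m₀ + 1)) ^ 2 * (2 ^ (n * (Nat.log 2 n + 1))) ^ 2 :=
        Nat.mul_le_mul (Nat.pow_le_pow_left hm₀ 2) (Nat.pow_le_pow_left hfact 2)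
    _ = 2 ^ (2 * (Nat.log 2 m₀ + 1) + 2 * (n * (Nat.log 2 n + 1))) := by
        rw [← pow_mul, ← pow_mul, ← pow_add]; ring_nf
    _ ≤ 2 ^ ((Nat.log 2 m₀ + Nat.log 2 n + 2) ^ 2) := Nat.pow_le_pow_right (by norm_num) hlarge

end Summit.ValiantsHypothesis.ValiantsHypothesis.Theorems.SymPencilEquivariantSdcNotQP.PermEmbedding


end
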